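import Summits.Langlands.Langlands.Theses.IrreducibilityBySelfDuality
import Summits.Langlands.Langlands.Theorems.IrreducibilityBySelfDualityIrreducibleOffSectorOfWeak
import Summits.Langlands.Langlands.Theorems.IrreducibilityBySelfDualityReciprocityUpToIrreducibilityWeakAutomorphyOfFontaineMazur
import Literature.NumberTheory.Automorphic.PairLFunctionPolesRepDataRankTwo
import Literature.NumberTheory.Automorphic.PairLFunctionPolesEqConjOfHumphriesJo

/-!
# Skeleton of line `Sketch` (isobaric bootstrap) for the crux `IrreducibleOffSector` — rev 6
(crux stmt-Langlands-14329, `Summit.Langlands.Langlands.Theses.IrreducibilityBySelfDuality.IrreducibleOffSector`,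
route `route-Langlands-IrreducibilityBySelfDuality`; continuation lead prover-line-stmt-Langlands-14329-c11-0.
History: rev 3 (lead -0, 2026-08-16T14:19Z; re-registered by c1 … c8) had stubs `stub_reciprocity : E`,
`stub_js22 : PairLBoundaryJS`, `stub_js23 : JacquetShalika1981_partialPairL_pole_repData`; rev 5 (c9, c10)
replaced E by 14328's two conjecture stubs W + lang.S03 and cut (2.3) to ranks `≥ 3`.)

## What rev 6 changes — the (2.3) stub becomes ONE archimedean local statement

Rev 5's fourth stub `stub_js23_rank_three_le` was Arthur–Clozel (2.3) for Borel–Jacquet data in ranks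
`≥ 3`: a GLOBAL analytic statement (a simple pole of `L^S(s, π ⊗ π')` at every `s₀ ∈ X`, for every pair
of cuspidal `π, π'` on `GL_n(𝔸_F)`, `n ≥ 3`, every number field `F`).  The tree now reduces it to a
single ARCHIMEDEAN LOCAL input: the named fact `HumphriesJo2024_archRankinSelberg_testVector n F`
(Humphries–Jo (2024) Thm. 1.1 / 5.6: a `K_∞`-finite test vector and a polynomial-times-Gaussian `Φ_∞`
computing the archimedean `GL_n × GL_n` Rankin–Selberg integral as `c^s ∏ Γ_ℝ(s + a_j) ∏ Γ_ℂ(s + b_j)`,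
plus absolute convergence for unitary data) — by the accepted chain
`JacquetShalika1981_partialPairL_pole_of_eq_conj_of_humphriesJo'` (`PairLFunctionPolesEqConjOfHumphriesJo`:
global Rankin–Selberg unfolding, Landau's lemma, the one-family reduction; (2.1) and the strict Satake
bound are theorems) and `JacquetShalika1981_partialPairL_pole_repData_rank` (`PairLFunctionPolesRepDataHolds`:
Borel–Jacquet data ↔ `L²`, unitary normalisation).  So rev 6 registers

* `stub_humphriesJo_three_le : ∀ N K, 3 ≤ N → HumphriesJo2024_archRankinSelberg_testVector N K`

in place of `stub_js23_rank_three_le`, and DERIVES the latter (`js23_rank_three_le_of_stub`, the old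
registered signature verbatim) and (2.3) in all ranks (`js23_of_stub`).  The new stub is the rank-`≥ 3`
part of the stub `stub_humphriesJo` registered VERBATIM on stmt-Langlands-13622's line (`PairLBoundaryJS`,
skeleton c5) — so after rev 6 EVERY stub of this skeleton is, by name or by text, a stub registered on
14328's or 13622's line or the item 13622 itself:

* `stub_weakExistence` (W) and `stub_fontaineMazurLanglandsGLn` (lang.S03) — VERBATIM 14328's two OPEN
  CONJECTURE stubs (Buzzard–Gee 3.2.1/3.2.2 existence half, weak form; Fontaine–Mazur–Langlands for `GL_n`);
* `stub_js22` — Arthur–Clozel (2.2) = the route input `PairLBoundaryJS` (stmt-Langlands-13622 BY NAME; its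
  line is down to `stub_MW_gap`, `stub_humphriesJo`, `stub_jacquet_corner`);
* `stub_humphriesJo_three_le` — Humphries–Jo in ranks `≥ 3` (⊂ 13622's `stub_humphriesJo`).

Hence `IrreducibleOffSector ⟸ W ∧ lang.S03 ∧ PairLBoundaryJS ∧ HJ_{≥3}`, and since 13622's own line
proves `PairLBoundaryJS ⟸ MW-gap ∧ HJ ∧ Jacquet-corner`, the crux's complete set of unproved leaves is
{W, lang.S03} ∪ {MW (i)(a) gap ≥ 2, Humphries–Jo, Jacquet 2009 corner} — two open conjectures and three
printed analytic theorems.  The same assembly is proposed for Literature as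
`JacquetShalika1981_partialPairL_pole_repData_of_humphriesJo_three_le` (p132630; it also discharges
14328's `stub_jsPole` from 13622's `stub_humphriesJo`).

Every theorem-grade step is LANDED: geometric Jordan–Hölder constituents and de Rham blocks
(p97031, p97895, p97213; 14328 lead p98936, p99702), k-ary isobaric rigidity for cuspidal Borel–Jacquet
data from Arthur–Clozel (2.1) [theorem], (2.2), (2.3) (p101770, p102635, p103420), the
Chebotarev–Brauer–Nesbitt transfer (p79199), the weak bootstrap (p112357), the lang.S03 bridge, and the
(2.3)-from-Humphries–Jo chain.  Landed structure of leads -0 … c9 (≈ 56 `--supports` files p79199 … p131819):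
closed regions (n = 1; n = 2 regular, any K; Galois type; monomial; n = 3 totally real regular; n = 4
totally real non-self-dual), closure operators (twist, base change descent/ascent, automorphic/tensor/
symmetric-power induction, duality, ι-transport), the constituent-level constraints (no abelian /
triangularisable avatar; a reducible E-rational avatar has a non-weakly-automorphic irreducible
constituent of rank 2 … n−1) and the certified maps v1–v4 of the residual open regions.
-/

noncomputable section

set_option linter.dupNamespace false

open scoped NumberField
open Filter IsDedekindDomain
open Literature.NumberTheory.Automorphic Literature.NumberTheory.GaloisRepresentations
open Summit.Langlands
open Summit.Langlands.Langlands.Theses.IrreducibilityBySelfDuality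

namespace Summit.Langlands.Langlands.Theorems.IrreducibleOffSector

/-! ## Stubs (all four are named externals: two open conjectures, one route input, one archimedean fact) -/

/-- Stub (W — weak existence; OPEN, Buzzard–Gee Conj. 3.2.1/3.2.2 existence half in its weak form;
VERBATIM the registered stub `stub_weakExistence` of stmt-Langlands-14328's line): every L-algebraic
cuspidal `π` on `GL_n(𝔸_K)` has, for all `ℓ, ι`, ONE `ρ : Γ_K → GL_n(ℚ̄_ℓ)` unramified almost
everywhere, de Rham above `ℓ` for Fontaine's pinned datum, and Satake–Frobenius compatible with
`(π, ι)` almost everywhere. -/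
theorem stub_weakExistence :
    ∀ (K : Type) [Field K] [NumberField K] (n : ℕ) (hcpt : isCompact_glFiniteIntegralLevel n K),
      0 < n → ∀ π : CuspidalAutomorphicRepData n K hcpt, π.1.IsLAlgebraic →
        ∀ (ℓ : ℕ) [Fact ℓ.Prime] (ι : PadicAlgCl ℓ ≃+* ℂ),
          ∃ ρ : FramedGaloisRep K (PadicAlgCl ℓ) n,
            ((∀ᶠ v : HeightOneSpectrum (𝓞 K) in cofinite, ρ.IsUnramifiedAt v) ∧
              ∀ (v : HeightOneSpectrum (𝓞 K)) (hv : ((ℓ : ℕ) : 𝓞 K) ∈ v.asIdeal),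
                (Literature.NumberTheory.PAdicHodge.fontainePstAdicCompletion v ℓ hv).IsDeRhamFramed
                  (ρ.toLocal v)) ∧
            ∀ᶠ v : HeightOneSpectrum (𝓞 K) in cofinite, SatakeFrobCompatibleAt ι π.1 ρ v := by
  sorry

/-- Stub (lang.S03 — Fontaine–Mazur–Langlands for `GL_n`, all `n`, at the pinned period-ring family;
OPEN; the accepted Literature conjecture text `FontaineMazurLanglandsGLn`, VERBATIM the registered stub
`stub_fontaineMazurLanglandsGLn` of stmt-Langlands-14328's line). -/
theorem stub_fontaineMazurLanglandsGLn :
    ∀ n : ℕ, FontaineMazurLanglandsGLn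
      (fun (K : Type) [Field K] [NumberField K] (ℓ : ℕ) [Fact ℓ.Prime]
          (v : HeightOneSpectrum (𝓞 K)) (hv : ((ℓ : ℕ) : 𝓞 K) ∈ v.asIdeal) =>
        ⟨(Literature.NumberTheory.PAdicHodge.fontainePstAdicCompletion v ℓ hv).algebra,
          (Literature.NumberTheory.PAdicHodge.fontainePstAdicCompletion v ℓ hv).𝔅⟩) n := by
  sorry

/-- Stub (route input item stmt-Langlands-13622 BY NAME): Arthur–Clozel (2.2) for Borel–Jacquet data. -/
theorem stub_js22 : PairLBoundaryJS := by
  sorry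

/-- Stub (Humphries–Jo archimedean test vectors for the `GL_N × GL_N` Rankin–Selberg integral in
ranks `N ≥ 3`: the Literature named fact `HumphriesJo2024_archRankinSelberg_testVector N K` — Humphries–Jo
(2024) Thm. 1.1 / Thm. 5.6 with Prop. 5.2, plus absolute convergence of the archimedean integrals for
unitary data (Jacquet–Shalika (1981) §3) — restricted to `3 ≤ N`; the rank-`≥ 3` part of the stub
`stub_humphriesJo` registered verbatim on stmt-Langlands-13622's line.  It replaces rev 5's
`stub_js23_rank_three_le` (Arthur–Clozel (2.3) in ranks `≥ 3`), which is DERIVED from it below.)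
[cite: HumphriesJo2024, Thm. 1.1, Prop. 5.2, Thm. 5.6] [cite: JacquetShalikaAJM1981, §3] -/
theorem stub_humphriesJo_three_le :
    ∀ (N : ℕ) (K : Type) [Field K] [NumberField K],
      3 ≤ N → HumphriesJo2024_archRankinSelberg_testVector N K := by
  sorry

/-! ## Glue (sorry-free) -/

/-- Rev 5's registered stub, now a theorem of the line modulo `stub_humphriesJo_three_le`:
**Arthur–Clozel (2.3) for Borel–Jacquet data in ranks `n ≥ 3`** (for cuspidal `π, π'` on `GL_n(𝔸_F)`,
unitary Satake families off a finite `S ⊇ S₀`, `s₀ ∈ X`: `(s - s₀) L^S(s, π ⊗ π') → c ≠ 0` as `s → s₀⁺`)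
— `JacquetShalika1981_partialPairL_pole_repData_rank` (Borel–Jacquet ↔ `L²`, unitary normalisation) fed
with the `L²` leaf `JacquetShalika1981_partialPairL_pole_of_eq_conj_of_humphriesJo'` (Rankin–Selberg
unfolding + Humphries–Jo test vector + Landau). [cite: ArthurClozelAMS120, Ch. 3 §2, (2.3), p. 171]
[cite: JacquetShalikaAJM1981II, Prop. 3.6] [cite: HumphriesJo2024, Thm. 1.1, Thm. 5.6] -/
theorem js23_rank_three_le_of_stub :
    ∀ (n : ℕ) (F : Type) [Field F] [NumberField F] (hF : isCompact_glFiniteIntegralLevel n F),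
      3 ≤ n → ∀ (π π' : CuspidalAutomorphicRepData n F hF),
      ∃ S₀ : Set (HeightOneSpectrum (𝓞 F)), S₀.Finite ∧
        ∀ {S : Set (HeightOneSpectrum (𝓞 F))} (_hS : S.Finite) (_hS₀ : S₀ ⊆ S)
          {α β : SatakeFamily F} (_hα : ∀ w ∉ S, π.1.HasSatakeParamAt w (α w))
          (_hβ : ∀ w ∉ S, π'.1.HasSatakeParamAt w (β w))
          (_hu : ∀ w ∉ S, ‖(α w).prod‖ = 1) (_hu' : ∀ w ∉ S, ‖(β w).prod‖ = 1)
          {s₀ : ℂ} (_hs₀ : s₀.re = 1)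
          (_hX : ∀ᶠ w in cofinite,
            (α w).map (((w.residueCard : ℂ) ^ (1 - s₀)) * ·) = (β w).map (·⁻¹)),
          ∃ c : ℂ, c ≠ 0 ∧
            Tendsto (fun s => (s - s₀) * partialPairL S α β s)
              (nhdsWithin s₀ {s : ℂ | 1 < s.re}) (nhds c) :=
  fun n F _ _ hF h3 π π' =>
    JacquetShalika1981_partialPairL_pole_repData_rank
      (fun μ _ => JacquetShalika1981_partialPairL_pole_of_eq_conj_of_humphriesJo' (μ := μ)
        (stub_humphriesJo_three_le n F h3))
      hF (by omega) π π'

/-- Arthur–Clozel (2.3) for Borel–Jacquet data in ALL ranks from the Humphries–Jo stub: ranks `≤ 2`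
are the in-tree theorem `JacquetShalika1981_partialPairL_pole_repData_rank_of_le_two`, ranks `≥ 3` are
`js23_rank_three_le_of_stub`. [cite: ArthurClozelAMS120, Ch. 3 §2, (2.3), p. 171] -/
theorem js23_of_stub : JacquetShalika1981_partialPairL_pole_repData :=
  fun n F _ _ hF hn π π' =>
    if h3 : 3 ≤ n then js23_rank_three_le_of_stub n F hF h3 π π'
    else JacquetShalika1981_partialPairL_pole_repData_rank_of_le_two (by omega) hF hn π π'

/-- B_w (weak automorphy of irreducible pinned-geometric `ρ : Γ_K → GL_n(ℚ̄_ℓ)`, every rank) from the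
lang.S03 stub, by the 14328 lead's landed bridge
`ReciprocityUpToIrreducibility.stub_weakAutomorphy_of_fontaineMazurLanglandsGLn` (global finite model by
Baire category, model independence of de Rham-ness). [cite: FontaineMazurGeometric1995, Conj. 1]
[cite: BuzzardGeeLMS2014, Conj. 3.2.2] -/
theorem weakAutomorphy_of_stub :
    ∀ (K : Type) [Field K] [NumberField K] (n : ℕ) (hcpt : isCompact_glFiniteIntegralLevel n K),
      0 < n → ∀ (ℓ : ℕ) [Fact ℓ.Prime] (ι : PadicAlgCl ℓ ≃+* ℂ) (ρ : FramedGaloisRep K (PadicAlgCl ℓ) n),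
        ρ.toGaloisRep.IsIrreducible →
        ((∀ᶠ v : HeightOneSpectrum (𝓞 K) in cofinite, ρ.IsUnramifiedAt v) ∧
          ∀ (v : HeightOneSpectrum (𝓞 K)) (hv : ((ℓ : ℕ) : 𝓞 K) ∈ v.asIdeal),
            (Literature.NumberTheory.PAdicHodge.fontainePstAdicCompletion v ℓ hv).IsDeRhamFramed
              (ρ.toLocal v)) →
          ∃ π : CuspidalAutomorphicRepData n K hcpt, π.1.IsLAlgebraic ∧
            ∀ᶠ v : HeightOneSpectrum (𝓞 K) in cofinite, SatakeFrobCompatibleAt ι π.1 ρ v :=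
  Summit.Langlands.Langlands.Theorems.ReciprocityUpToIrreducibility.stub_weakAutomorphy_of_fontaineMazurLanglandsGLn
    stub_fontaineMazurLanglandsGLn

/-! ## The crux from the stubs -/

/-- **The crux from the stubs**: `IrreducibleOffSector` (for EVERY `π`; the sector hypothesis is
idle) from weak existence (W), Fontaine–Mazur–Langlands (lang.S03, giving B_w), Arthur–Clozel (2.2)
and the Humphries–Jo archimedean fact in ranks `≥ 3` (giving (2.3)), by the landed pointwise-weak
bootstrap `irreducibleOffSector_text_of_weak` (p112357) — the route decls are definitionally their texts. -/
theorem IrreducibleOffSector_of : IrreducibleOffSector :=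
  irreducibleOffSector_text_of_weak stub_js22 js23_of_stub stub_weakExistence weakAutomorphy_of_stub

end Summit.Langlands.Langlands.Theorems.IrreducibleOffSector

end
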